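import Summits.ResolutionOfSingularities.ResolutionOfSingularities.Theorems.ThreadCutLaw2
import Summits.ResolutionOfSingularities.ResolutionOfSingularities.Theorems.ProximityCutOrigin
import Mathlib.Algebra.Order.Chebyshev
import HarnessLib

/-!
# HeronCutLaw — decomp-res node «HeronCut» (lens-5 g32, critic row 201 CLEARED (T-3) +1), tree file 1/3 of the node

Content VERBATIM from the decomp-res lens-5 g32 node «HeronCut», LANDING SHAPE (A′)/(B′) prepared by the lens itself: `HOME/decomp-res-lens-5/g32/landing/HeronCutLaw.lean` (sha256 ea49c374, 547 l) and `landing/HeronCutStar.lean` (sha256 0944ef8c, 268 l) = §1–§4 / §5–§7 of the NEW part (l. 689–1406) of the node `HOME/decomp-res-lens-5/g32/HeronCut.lean` (5c18aa6a, 1406 l), with the node's CARRY of g31 «ThreadCut» §1–§5 replaced by imports of the LANDED rider-198 files `ThreadCutLaw` / `ThreadCutLaw2` / `ThreadCutPinf` (writer g12, 2026-08-31); shas verified = PIN STATUS 2026-08-31T08:54:16Z; HOME = run/shared/lean/pub/decomp-res.  Namespaces as in the node: `…Theorems.HeronCut` (NEW: the potential and the abstract engine) and `…Theorems.ThreadCut`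 (lens-5's own, continued: the thread law, walks, tristar, star roots, desk); every declaration is new.  Farm (node; lens + critic runs): rc 0 · 0 err · 0 warn · 0 sorry; axioms std on 14 decls incl. `heron_transvection`, `heron_nonpos_of_mixed`, `light_steps_le_budget`, `all_letter_eventually_heavy`, `Thread.cornerTail_light_steps_le`, `Thread.eventually_offHeavy_of_cornerTail`, `Thread.no_light_io_cornerTail`, `ForcedWalk.no_cornerTail`, `ForcedWalk.translating`, `Thread.ofTristar`, `star32_isRoot`, `star32_cyclic_recurs` (no ofReduceBool); Probe 7/7 must-fail.  Critic: CRITIC-LEDGER row 201 «HeronCut» CLEARED — window row 198 item (T-3) «ALL CORNER THREADS decided in walk currency» DECIDED +1 ONCE · MAP 0 («a model delivery: desk first, kind pre-stated, new invariant, walk-currency corollary, honest tree audit»): THE HERON POTENTIAL `Ψ(ρ) = (Σρ)² − (n−1)·Σρ²` of a defect vector with the EXACT transvection law `heron_transvection` (`+2(n−1)ρ_j²` under every corner step, any alphabet) and `heron_nonpos_of_mixed`; the ALL-LETTER ENGINE `all_letter_eventually_heavy` / `light_steps_le_budget` (g31's two-letter engine with every word hypothesis deleted); THE THREAD CORNER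 LAW FOR ALL CHARTS `Thread.eventually_offHeavy_of_cornerTail` (KERNEL, hypothesis-free: binders exactly (Thread, T₀, CornerTailFrom)), quantitative `Thread.cornerTail_light_steps_le`, the EMPTY cell `Thread.no_light_io_cornerTail`, the star regime; WALK currency `ForcedWalk.no_cornerTail` ⇒ `ForcedWalk.translating` (every forced walk translates i.o.); recoveries as one-liners (`noOriginTails_of_heron`, `corner_tail_uses_all_charts'`, cited 0); EXACTNESS `Thread.ofTristar` + the certified star roots (`star32_isRoot`, `star32_cyclic_recurs`).  Located residual of the thread axis after the node: TRANSLATING threads only (`Thread.Translating`; window g33 (T-tr)).  Landing orders = critic rider INBOX :1252 (2026-08-31T08:57:52Z): after rider 198's (A) `ThreadCutLaw` and (B) `ThreadCutPinf` (landed, g12): (A′) `HeronCutLaw` := landing/HeronCutLaw.lean (imports `ThreadCutLaw` + `ProximityCutOrigin` + `Mathlib.Algebra.Order.Chebyshev` kept explicit + HarnessLib), then (B′) `HeronCutStar` := landing/HeronCutStar.lean (imports `HeronCutLaw` + `ThreadCutPinf`); both `--kind proof --supports stmt-ResolutionOfSingularities-31770`; no aside switch, no item.  The `def … : Prop` declarations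 (`Tristar`) are THIS node's thread / stage predicates — none is a vendored fact.  The (A′) landing header (57 lines: kind, tree audit, the lever, the law, exactness, desk) is reproduced VERBATIM in part 2 of the node, `HeronCutLaw2` — this first part has no room for it under the 400-line cap.

## This file

§1 THE HERON POTENTIAL (`namespace …HeronCut`, `section Heron`; pure algebra over any finite alphabet `L`): `heron ρ
= (Σρ)² − (|L|−1)·Σρ²`, the chart transvection `transvect`, **`heron_transvection`** (`Ψ(T_jρ) = Ψ(ρ) + 2(n−1)ρ_j²`,
exact), `heron_nonpos_of_mixed` (a negative and a non-negative coordinate ⇒ `Ψ ≤ 0`, Chebyshev / Cauchy–Schwarz —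
hence the explicit `Mathlib.Algebra.Order.Chebyshev` import) and the monotonicity corollaries; §2 THE ALL-LETTER
ENGINE (`section Engine`): light / heavy letters of a support, `charge`, the LIGHT BUDGET,
**`light_steps_le_budget`** and **`all_letter_eventually_heavy`** (= g31's `two_letter_eventually_heavy` with every
word hypothesis deleted).

[WRITER NOTE (decomp-res writer g13): file split only — (A′) is 547 lines, over the tree's 400-line cap, and is cut
at the node's own root-namespace boundary: `HeronCutLaw` = `namespace …Theorems.HeronCut` (§1–§2), `HeronCutLaw2` =
`namespace …Theorems.ThreadCut` (§3–§4); (B′) `HeronCutStar` is one file; sections, section variables, `open … in`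
combinators and every declaration exactly as in the landing files; the file-level `open` lines are replayed in each
part.  TWO writer token fixes, both forced: (i) the landing files' import lines spell the module prefix `Summit.…`
(a typo — the tree's modules are `Summits.…`, as in the node file itself) → `Summits.…`; (ii) `ThreadCutLaw` was cut
by the cap into `ThreadCutLaw` + `ThreadCutLaw2` at its landing (g12), so (A′) imports `ThreadCutLaw2` (⊇
`ThreadCutLaw`) to have the whole of g31 §1–§4 in scope, and (B′) imports `HeronCutLaw2` (⊇ `HeronCutLaw`).]

(Sources: Hauser2010 §§F–G (kangaroo points, corner/translation moves); CossartJannsenSaito2020 Ch. 8;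
HauserPerlega2019 §2; Hironaka1964 Ch. III.)
-/

open MvPolynomial
open Literature.AlgebraicGeometry.Resolution
open Literature.AlgebraicGeometry.Resolution.Hauser2010
open Literature.AlgebraicGeometry.Resolution.PointBlowup
open Summit.ResolutionOfSingularities.ResolutionOfSingularities.Theorems.TightDefectClasses
open Summit.ResolutionOfSingularities.ResolutionOfSingularities.Theorems.CornerTowerDescent
open Summit.ResolutionOfSingularities.ResolutionOfSingularities.Theorems.LassoCut

/-! # HeronCut — §1–§2: the HERON POTENTIAL and the all-letter light budget (lens-5 g32, new content) -/

namespace Summit.ResolutionOfSingularities.ResolutionOfSingularities.Theorems.HeronCut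

open Finset

section Heron

variable {L : Type} [Fintype L] [DecidableEq L]

/-! ## §1 THE HERON POTENTIAL `Ψ(ρ) = (Σρ)² − (n−1)·Σρ²` on defect vectors (pure algebra, any finite alphabet) -/

/-- **HERON POTENTIAL** of an integer vector over a finite alphabet `L` (`n = |L|` letters):
`Ψ(ρ) = (Σ_k ρ_k)² − (n − 1)·Σ_k ρ_k²`.  For `n = 3` this is `2e₂(ρ) − Σρ² = 4ρ₁ρ₂ − (ρ₀ − ρ₁ − ρ₂)²`, i.e. HERON's
`16·Area²` of the triangle with sides `ρ` — a LORENTZIAN form of signature `(+,−,−)`; for `n = 2` it is `2ρ₀ρ₁`, the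
product potential `π` of the two-letter corner law.  DEFINITION (the node's NEW QUANTITY). [new] -/
def heron (ρ : L → ℤ) : ℤ := (∑ k, ρ k) ^ 2 - ((Fintype.card L : ℤ) - 1) * ∑ k, ρ k ^ 2

omit [DecidableEq L] in
/-- an inhabited alphabet has at least one letter. [folklore] -/
theorem one_le_card (j : L) : 1 ≤ Fintype.card L := Fintype.card_pos_iff.mpr ⟨j⟩

/-- `#(L ∖ {j}) = n − 1` in `ℤ`. [folklore] -/
theorem card_univ_erase_cast (j : L) : ((#(univ.erase j) : ℕ) : ℤ) = (Fintype.card L : ℤ) - 1 := by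
  rw [card_erase_of_mem (mem_univ j), card_univ, Nat.cast_sub (one_le_card j), Nat.cast_one]

/-- **(H1) THE TRANSVECTION LAW.**  Under the corner transvection in the letter `j` (`ρ'_j = ρ_j`, `ρ'_k = ρ_k + ρ_j` for
`k ≠ j` — the chart-`u_j` exponent law on defects) the Heron potential increases by EXACTLY `2(n−1)·ρ_j²`, whatever the
other coordinates: `Ψ(T_j ρ) = Ψ(ρ) + 2(n−1)ρ_j²`.  (One polynomial identity; the cross terms cancel because the
coefficient of `Σρ²` is `n − 1`.) [new — PROVED here] [folklore] -/
theorem heron_transvection {ρ ρ' : L → ℤ} {j : L} (hj : ρ' j = ρ j) (hk : ∀ k, k ≠ j → ρ' k = ρ k + ρ j) :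
    heron ρ' = heron ρ + 2 * ((Fintype.card L : ℤ) - 1) * ρ j ^ 2 := by
  have hc := card_univ_erase_cast j
  have e1 : ∑ k, ρ' k = ρ' j + ∑ k ∈ univ.erase j, ρ' k := (add_sum_erase univ _ (mem_univ j)).symm
  have e2 : ∑ k, ρ k = ρ j + ∑ k ∈ univ.erase j, ρ k := (add_sum_erase univ _ (mem_univ j)).symm
  have e3 : ∑ k, ρ' k ^ 2 = ρ' j ^ 2 + ∑ k ∈ univ.erase j, ρ' k ^ 2 :=
    (add_sum_erase univ (fun k => ρ' k ^ 2) (mem_univ j)).symm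
  have e4 : ∑ k, ρ k ^ 2 = ρ j ^ 2 + ∑ k ∈ univ.erase j, ρ k ^ 2 :=
    (add_sum_erase univ (fun k => ρ k ^ 2) (mem_univ j)).symm
  have h1' : ∑ k ∈ univ.erase j, ρ' k = ∑ k ∈ univ.erase j, (ρ k + ρ j) :=
    sum_congr rfl fun k hk' => hk k (ne_of_mem_erase hk')
  have h1 : ∑ k ∈ univ.erase j, ρ' k = ∑ k ∈ univ.erase j, ρ k + ((Fintype.card L : ℤ) - 1) * ρ j := by
    rw [h1', sum_add_distrib, sum_const, nsmul_eq_mul, hc]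
  have h2' : ∑ k ∈ univ.erase j, ρ' k ^ 2 = ∑ k ∈ univ.erase j, (ρ k ^ 2 + (2 * ρ j * ρ k + ρ j ^ 2)) :=
    sum_congr rfl fun k hk' => by rw [hk k (ne_of_mem_erase hk')]; ring
  have h2 : ∑ k ∈ univ.erase j, ρ' k ^ 2 =
      ∑ k ∈ univ.erase j, ρ k ^ 2 + (2 * ρ j * ∑ k ∈ univ.erase j, ρ k + ((Fintype.card L : ℤ) - 1) * ρ j ^ 2) := by
    rw [h2', sum_add_distrib, sum_add_distrib, ← mul_sum, sum_const, nsmul_eq_mul, hc]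
  unfold heron
  rw [e1, e2, e3, e4, h1, h2, hj]
  ring

/-- **(H2) THE MIXED-SIGN LAW.**  If one coordinate is negative and another is non-negative then `Ψ(ρ) ≤ 0`: with the
negative index `i₀` dropped (if `Σρ ≥ 0`) resp. the non-negative index `i₁` dropped (if `Σρ < 0`), `(Σρ)²` is at most
the square of the remaining `n − 1` coordinates' sum, which CAUCHY–SCHWARZ (`sq_sum_le_card_mul_sum_sq`) bounds by
`(n−1)·Σρ²`.  [new — PROVED here] [folklore] -/
theorem heron_nonpos_of_mixed {ρ : L → ℤ} {i₀ i₁ : L} (h₀ : ρ i₀ < 0) (h₁ : 0 ≤ ρ i₁) : heron ρ ≤ 0 := by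
  have drop : ∀ i, (∑ k ∈ univ.erase i, ρ k) ^ 2 ≤ ((Fintype.card L : ℤ) - 1) * ∑ k, ρ k ^ 2 := by
    intro i
    calc (∑ k ∈ univ.erase i, ρ k) ^ 2 ≤ #(univ.erase i) * ∑ k ∈ univ.erase i, ρ k ^ 2 := sq_sum_le_card_mul_sum_sq
      _ ≤ #(univ.erase i) * ∑ k, ρ k ^ 2 :=
          mul_le_mul_of_nonneg_left
            (sum_le_sum_of_subset_of_nonneg (erase_subset i univ) fun k _ _ => sq_nonneg (ρ k)) (by positivity)
      _ = ((Fintype.card L : ℤ) - 1) * ∑ k, ρ k ^ 2 := by rw [card_univ_erase_cast]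
  have e0 : ∑ k, ρ k = ρ i₀ + ∑ k ∈ univ.erase i₀, ρ k := (add_sum_erase univ _ (mem_univ i₀)).symm
  have e1 : ∑ k, ρ k = ρ i₁ + ∑ k ∈ univ.erase i₁, ρ k := (add_sum_erase univ _ (mem_univ i₁)).symm
  unfold heron
  by_cases hs : 0 ≤ ∑ k, ρ k
  · have d := drop i₀
    nlinarith [mul_nonneg hs (show (0 : ℤ) ≤ ∑ k ∈ univ.erase i₀, ρ k - ∑ k, ρ k by linarith)]
  · have d := drop i₁
    push Not at hs
    nlinarith [mul_nonneg (show (0 : ℤ) ≤ -∑ k, ρ k by linarith)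
      (show (0 : ℤ) ≤ ∑ k, ρ k - ∑ k ∈ univ.erase i₁, ρ k by linarith)]

/-- the Heron potential on a TWO-letter alphabet is the product potential `2ρ₀ρ₁` (g30/g31's `π`, up to the factor 2).
[folklore] -/
theorem heron_fin_two (ρ : Fin 2 → ℤ) : heron ρ = 2 * ρ 0 * ρ 1 := by
  simp [heron, Fin.sum_univ_two]; ring

/-- the Heron potential on THREE letters is HERON's `16·Area² = 4bc − (a − b − c)²` (Lorentzian, signature `(+,−,−)`).
[folklore] -/
theorem heron_fin_three (ρ : Fin 3 → ℤ) : heron ρ = 4 * ρ 1 * ρ 2 - (ρ 0 - ρ 1 - ρ 2) ^ 2 := by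
  simp [heron, Fin.sum_univ_three]; ring

end Heron

section Engine

variable {A L : Type} [DecidableEq A] [Fintype L] [DecidableEq L]

/-! ## §2 THE ALL-LETTER ENGINE: an explicit LIGHT BUDGET, no recurrence hypothesis, any finite alphabet -/

/-- the DEFECT VECTOR of an element: `ρ_k(a) = off_k(a) − n`. DEFINITION (support). -/
def defect (n : ℕ) (off : L → A → ℕ) (a : A) : L → ℤ := fun k => (off k a : ℤ) - n

open Classical in
/-- the LIGHT CHARGE of an element: `1 − Ψ(ρ(a))` if some letter is light for `a` (`off_k a < n`), else `0`.
DEFINITION (support). -/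
noncomputable def charge (n : ℕ) (off : L → A → ℕ) (a : A) : ℕ :=
  if ∃ k, off k a < n then (1 - heron (defect n off a)).toNat else 0

/-- the **LIGHT BUDGET** of a finite set of elements: the sum of the light charges. DEFINITION (support). -/
noncomputable def budget (n : ℕ) (off : L → A → ℕ) (s : Finset A) : ℕ := ∑ a ∈ s, charge n off a

/-- **THE ALL-LETTER LIGHT BUDGET** (KERNEL of the node; abstract, any finite alphabet `L`, ANY word `dir`).  Setting as
in g31's `two_letter_eventually_heavy` MINUS every hypothesis on the word (no `J ≠ K`, no «only two letters occur», no
recurrence): finite sets `S i`, maps `φ i` playing the letter `dir i` — `off_{dir i}` unchanged, every other `off_k`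
changes by `off_{dir i} − n`, the degree by the same, `S (i+1) ⊆ φ i '' (S i)`, LIGHT elements (`off_{dir i} < n`) always
survive.  CONCLUSION: the number of LIGHT STEPS (steps at which some element of `S i` is light for the played letter) is
AT MOST `budget n off (S 0) = Σ_{a light} (1 − Ψ(ρ(a)))`.  Proof: an all-light element would lose degree forever, so
every light element is MIXED, hence `Ψ ≤ 0` (H2) and its charge is `≥ 1`; by (H1) charges never increase along `φ` and
DROP by `≥ 2(n−1)ρ² ≥ 2` at an element light for the played letter; images only merge.  [new — PROVED here] [folklore] -/
theorem light_steps_le_budget (n : ℕ) (deg : A → ℕ) (off : L → A → ℕ) (S : ℕ → Finset A) (φ : ℕ → A → A)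
    (dir : ℕ → L)
    (hsame : ∀ i a, off (dir i) (φ i a) = off (dir i) a)
    (hother : ∀ i a k, k ≠ dir i → n ≤ deg a → off k (φ i a) + n = off k a + off (dir i) a)
    (hdeg : ∀ i a, n ≤ deg a → deg (φ i a) + n = deg a + off (dir i) a)
    (hS : ∀ i, S (i + 1) ⊆ (S i).image (φ i))
    (hkeep : ∀ i, ∀ a ∈ S i, off (dir i) a < n → φ i a ∈ S (i + 1))
    (hle : ∀ i, ∀ a ∈ S i, n ≤ deg a) (T : Finset ℕ) (hT : ∀ i ∈ T, ∃ a ∈ S i, off (dir i) a < n) :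
    #T ≤ budget n off (S 0) := by
  classical
  -- (1) no ALL-LIGHT element: it would lose degree at every later step
  have hAN : ∀ i, ∀ a ∈ S i, ¬ ∀ k, off k a < n := by
    intro i a ha hall
    have desc : ∀ m, ∃ b ∈ S (i + m), (∀ k, off k b < n) ∧ deg b + m ≤ deg a := by
      intro m
      induction m with
      | zero => exact ⟨a, ha, hall, le_rfl⟩
      | succ m ih =>
        obtain ⟨b, hb, hbl, hbd⟩ := ih
        have hnb := hle _ b hb
        have hd := hdeg (i + m) b hnb
        have hl := hbl (dir (i + m))
        refine ⟨φ (i + m) b, hkeep _ b hb hl, fun k => ?_, by omega⟩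
        by_cases hk : k = dir (i + m)
        · rw [hk, hsame]; exact hl
        · have h1 := hother (i + m) b k hk hnb
          have h2 := hbl k
          omega
    obtain ⟨b, -, -, hbd⟩ := desc (deg a + 1)
    omega
  have hmixed : ∀ i, ∀ a ∈ S i, ∃ k, n ≤ off k a := by
    intro i a ha
    by_contra h
    push Not at h
    exact hAN i a ha h
  -- (2) the transvection law for defect vectors along φ
  have htv : ∀ i a, n ≤ deg a → heron (defect n off (φ i a)) =
      heron (defect n off a) + 2 * ((Fintype.card L : ℤ) - 1) * (defect n off a (dir i)) ^ 2 := by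
    intro i a hna
    refine heron_transvection ?_ ?_
    · simp only [defect, hsame]
    · intro k hk
      have h1 := hother i a k hk hna
      simp only [defect]
      omega
  -- (3) no light letter stays no light letter
  have hnolight : ∀ i a, n ≤ deg a → (¬ ∃ k, off k a < n) → ¬ ∃ k, off k (φ i a) < n := by
    rintro i a hna hl ⟨k, hk⟩
    push Not at hl
    by_cases hkd : k = dir i
    · rw [hkd, hsame] at hk
      exact absurd (hl (dir i)) (not_le.mpr hk)
    · have h1 := hother i a k hkd hna
      have h2 := hl k
      have h3 := hl (dir i)
      omega
  have hcard1 : (0 : ℤ) ≤ (Fintype.card L : ℤ) - 1 := by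
    rcases isEmpty_or_nonempty L with hL | ⟨⟨j⟩⟩
    · -- an empty alphabet has no light letters at all; the bound below is not needed, but `0 ≤ card - 1` may fail:
      -- we only use `hcard1` under a letter `dir i`, so derive it from that letter instead (see `hmono`)
      exact (hL.false (dir 0)).elim
    · have := one_le_card j
      omega
  -- (4) charges never increase along φ …
  have hmono : ∀ i, ∀ a ∈ S i, charge n off (φ i a) ≤ charge n off a := by
    intro i a ha
    have hna := hle i a ha
    unfold charge
    by_cases hl : ∃ k, off k a < n
    · rw [if_pos hl]
      obtain ⟨k₀, hk₀⟩ := hl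
      obtain ⟨k₁, hk₁⟩ := hmixed i a ha
      have hmix : heron (defect n off a) ≤ 0 :=
        heron_nonpos_of_mixed (i₀ := k₀) (i₁ := k₁) (by simp only [defect]; omega) (by simp only [defect]; omega)
      split_ifs with hl'
      · rw [htv i a hna]
        have h0 : 0 ≤ 2 * ((Fintype.card L : ℤ) - 1) * defect n off a (dir i) ^ 2 :=
          mul_nonneg (mul_nonneg (by norm_num) hcard1) (sq_nonneg _)
        omega
      · exact Nat.zero_le _
    · rw [if_neg hl, if_neg (hnolight i a hna hl)]
  -- … and DROP at an element light for the played letter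
  have hstrict : ∀ i, ∀ a ∈ S i, off (dir i) a < n → charge n off (φ i a) < charge n off a := by
    intro i a ha hlow
    have hna := hle i a ha
    obtain ⟨k₁, hk₁⟩ := hmixed i a ha
    have hne : dir i ≠ k₁ := fun h => by rw [h] at hlow; omega
    have hc2 : (2 : ℤ) ≤ Fintype.card L := by
      exact_mod_cast Fintype.one_lt_card_iff_nontrivial.mpr ⟨⟨dir i, k₁, hne⟩⟩
    have hmix : heron (defect n off a) ≤ 0 :=
      heron_nonpos_of_mixed (i₀ := dir i) (i₁ := k₁) (by simp only [defect]; omega) (by simp only [defect]; omega)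
    have hρ : defect n off a (dir i) ≤ -1 := by simp only [defect]; omega
    have hsq : 1 ≤ defect n off a (dir i) ^ 2 := by nlinarith
    have hinc : 2 ≤ 2 * ((Fintype.card L : ℤ) - 1) * defect n off a (dir i) ^ 2 := by nlinarith
    unfold charge
    rw [if_pos (show ∃ k, off k a < n from ⟨dir i, hlow⟩)]
    split_ifs with hl'
    · rw [htv i a hna]; omega
    · omega
  -- (5) the total charge `V i` is non-increasing and drops by ≥ 1 at every light step
  set V : ℕ → ℤ := fun i => ∑ a ∈ S i, (charge n off a : ℤ) with hV
  have hstep : ∀ i, V (i + 1) ≤ ∑ a ∈ S i, (charge n off (φ i a) : ℤ) := by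
    intro i
    calc V (i + 1) ≤ ∑ a ∈ (S i).image (φ i), (charge n off a : ℤ) :=
          sum_le_sum_of_subset_of_nonneg (hS i) fun a _ _ => by positivity
      _ ≤ ∑ a ∈ S i, (charge n off (φ i a) : ℤ) := sum_image_le_of_nonneg fun a _ => by positivity
  have hVle : ∀ i, V (i + 1) ≤ V i := fun i =>
    (hstep i).trans (sum_le_sum fun a ha => by exact_mod_cast hmono i a ha)
  have hVlt : ∀ i, (∃ a ∈ S i, off (dir i) a < n) → V (i + 1) + 1 ≤ V i := by
    rintro i ⟨a, ha, hlow⟩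
    have hlt : ∑ a ∈ S i, (charge n off (φ i a) : ℤ) < V i :=
      sum_lt_sum (fun a ha => by exact_mod_cast hmono i a ha) ⟨a, ha, by exact_mod_cast hstrict i a ha hlow⟩
    have := hstep i
    omega
  -- (6) counting the light steps below `M`
  have hcount : ∀ M, (∑ i ∈ range M, if i ∈ T then (1 : ℤ) else 0) + V M ≤ V 0 := by
    intro M
    induction M with
    | zero => simp
    | succ M ih =>
      rw [sum_range_succ]
      by_cases hM : M ∈ T
      · rw [if_pos hM]; have := hVlt M (hT M hM); linarith
      · rw [if_neg hM]; have := hVle M; linarith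
  obtain ⟨M, hM⟩ : ∃ M, T ⊆ range M :=
    ⟨T.sup id + 1, fun i hi => mem_range.mpr (Nat.lt_succ_of_le (le_sup (f := id) hi))⟩
  have hTsum : (∑ i ∈ range M, if i ∈ T then (1 : ℤ) else 0) = #T := by
    rw [sum_boole, filter_mem_eq_inter, inter_eq_right.mpr hM]
  have hV0 : V 0 = budget n off (S 0) := by simp [hV, budget]
  have hVM : 0 ≤ V M := sum_nonneg fun a _ => by positivity
  have hfin := hcount M
  rw [hTsum, hV0] at hfin
  have hfin' : (#T : ℤ) ≤ budget n off (S 0) := by linarith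
  exact_mod_cast hfin'

/-- **THE ALL-LETTER LAW** (eventual form): in the setting of `light_steps_le_budget`, from some step on EVERY element is
HEAVY for the played letter — for ANY word, with NO recurrence hypothesis (g31's `two_letter_eventually_heavy` is the
case «only two letters occur»; the tree's `dyn3_eventually` is the case «every letter recurs»).  [new — PROVED here]
[folklore] -/
theorem all_letter_eventually_heavy (n : ℕ) (deg : A → ℕ) (off : L → A → ℕ) (S : ℕ → Finset A) (φ : ℕ → A → A)
    (dir : ℕ → L)
    (hsame : ∀ i a, off (dir i) (φ i a) = off (dir i) a)
    (hother : ∀ i a k, k ≠ dir i → n ≤ deg a → off k (φ i a) + n = off k a + off (dir i) a)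
    (hdeg : ∀ i a, n ≤ deg a → deg (φ i a) + n = deg a + off (dir i) a)
    (hS : ∀ i, S (i + 1) ⊆ (S i).image (φ i))
    (hkeep : ∀ i, ∀ a ∈ S i, off (dir i) a < n → φ i a ∈ S (i + 1))
    (hle : ∀ i, ∀ a ∈ S i, n ≤ deg a) :
    ∃ N, ∀ i, N ≤ i → ∀ a ∈ S i, n ≤ off (dir i) a := by
  classical
  by_contra h
  push Not at h
  choose f hf using h
  -- a strictly increasing sequence of light steps, longer than the budget
  let g : ℕ → ℕ := fun k => Nat.rec (f 0) (fun _ gk => f (gk + 1)) k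
  have hg_succ : ∀ k, g (k + 1) = f (g k + 1) := fun _ => rfl
  have hg_lt : ∀ k, g k < g (k + 1) := fun k => by rw [hg_succ]; exact (hf _).1
  have hg_light : ∀ k, ∃ a ∈ S (g k), off (dir (g k)) a < n := by
    intro k
    cases k with
    | zero => exact (hf 0).2
    | succ k => rw [hg_succ]; exact (hf _).2
  have hinj : Function.Injective g := (strictMono_nat_of_lt_succ hg_lt).injective
  have hB := light_steps_le_budget n deg off S φ dir hsame hother hdeg hS hkeep hle
    ((range (budget n off (S 0) + 1)).image g)
    (fun i hi => by obtain ⟨k, -, rfl⟩ := mem_image.mp hi; exact hg_light k)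
  rw [card_image_of_injective _ hinj, card_range] at hB
  omega

end Engine

end Summit.ResolutionOfSingularities.ResolutionOfSingularities.Theorems.HeronCut
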